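import Summits.QuantumFields.GaugeBoot.DiagonalRPTorusNegativeHighDimUniform
import HarnessLib

/-!
# No finite-torus route to Class B in `d ≥ 4` for `SU(N)` / `U(N)` (gauge-boot, L3 uniform window, summary)

HONEST FRAMING (cell `pub-gaugeboot`, page 1 of every file): the venture produces certified bounds
on lattice expectations at stated coupling, gauge group, dimension and torus size; NOT a mass gap,
NOT a continuum limit, NOT a string tension; NOT Yang–Mills-summit-bearing (barriers
`FixedCouplingUltralocality`, `PerturbativeInvisibility`). This module records COROLLARIES of the
uniform-window negatives `DiagonalRPTorusInnerHalfNegativeHighDimUniform` /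
`DiagonalRPTorusClosedHalfNegativeHighDimUniform`, in the exact hypothesis shape of the cell's
Class-B transfer; it discharges nothing else.

## Content

`DiagonalRPTorusThreeNoTransfer` records, for `d = 3` and SIGN-CHARACTER groups (`ℤ₂` lattice gauge
theory), that the hypothesis of the Class-B transfer
`ClassBLimitDiagonalGeometry.torusLimitPointsDiagonalRP_of_innerDiagonalRP`,

  `∀ i j : Fin d, i ≠ j → ∃ L₀, ∀ L, L₀ ≤ L → InnerDiagonalRP (d := d) (L := L + 1) ρ β i j`,

fails at every fixed `0 < β ≤ 1/5000` — the window being uniform in `L` there because the `ℤ₂`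
expansion is a polynomial identity. For the venture's own groups `SU(N)` / `U(N)` the tree had only
`L`-dependent windows `β₀(L, N, d)` (tribunal t1, A3: "a uniform-in-`L` window would be an honest
sub-rung of R9"). With the uniform windows of this sequel, for EVERY `d ≥ 4`:

* **`DiagRPUnif.not_eventually_innerDiagonalRP_highDim_suN`** (`N ≥ 2`) /
  **`_uN`** (`N ≥ 1`) — there is `β₀ = β₀(N, d) > 0` such that for every `0 < β ≤ β₀` the transfer
  hypothesis above is FALSE (the pair `(0,1)` and the even tori violate it);
* **`DiagRPUnif.not_eventually_diagonalReflectionPositive_odd_highDim_suN`** / **`_uN`** — nor is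
  closed-half diagonal RP across `x₀ = x₁` eventually available along the odd tori, for the same
  `β`.

## What is NOT claimed

Nothing about `TorusLimitPointsDiagonalRP d ρ β` or `ThermodynamicLimitIsClassB d ρ β` themselves
(at small `β` the infinite-volume state is unique and diagonal-RP, `ClassBStrongCoupling`); only
the finite-torus ROUTE to them is closed in `d ≥ 4`, now for `SU(N)` and `U(N)` and at every fixed
small coupling. The case `d = 3` for `SU(N)` / `U(N)` keeps its `L`-dependent window
(`DiagonalRPTorusNegativeAllTori`). Sources / precedent as in `DiagonalRPTorusThreeNoTransfer`
(Osterwalder–Seiler 1978 §§2–3; FILS 1980 §3; Biskup 2009 §5.5).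
-/

namespace Summit.QuantumFields.GaugeBoot

open Literature.MathematicalPhysics.QuantumFieldTheory
open Literature.MathematicalPhysics.QuantumLattice

noncomputable section

namespace DiagRPUnif

/-- **The Class-B transfer cannot be fed in `d ≥ 4` for `SU(N)` (`N ≥ 2`), at any fixed small
coupling.** There is `β₀ = β₀(N, d) > 0` such that for every `0 < β ≤ β₀` the hypothesis "inner-half
diagonal RP of all large tori for every pair of directions" fails: the pair `(0, 1)` and the even
tori violate it (`not_innerDiagonalRP_even_suN_highDim_uniform`). -/
theorem not_eventually_innerDiagonalRP_highDim_suN {d N : ℕ} (hd : 4 ≤ d) (hN : 2 ≤ N) :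
    ∃ β₀ : ℝ, 0 < β₀ ∧ ∀ β : ℝ, 0 < β → β ≤ β₀ →
      ¬ (∀ i j : Fin d, i ≠ j → ∃ L₀ : ℕ, ∀ L : ℕ, L₀ ≤ L →
        InnerDiagonalRP (d := d) (L := L + 1) (fundamentalRep (Fin N)) β i j) := by
  obtain ⟨β₀, hβ₀, h⟩ := not_innerDiagonalRP_even_suN_highDim_uniform hd hN
  refine ⟨β₀, hβ₀, fun β hβ hβ1 H => ?_⟩
  obtain ⟨L₀, hL₀⟩ := H ⟨0, by omega⟩ ⟨1, by omega⟩ (by simp)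
  exact h (2 * L₀ + 5 + 1) ⟨L₀ + 3, by ring⟩ (by omega) β hβ hβ1 (hL₀ (2 * L₀ + 5) (by omega))

/-- **Nor along the odd tori with the closed half (`SU(N)`, `N ≥ 2`, `d ≥ 4`).** For every
`0 < β ≤ β₀(N, d)`, closed-half diagonal RP across `x₀ = x₁` is not eventually available along the
odd tori (`not_diagonalReflectionPositive_odd_suN_highDim_uniform`). -/
theorem not_eventually_diagonalReflectionPositive_odd_highDim_suN {d N : ℕ} (hd : 4 ≤ d)
    (hN : 2 ≤ N) :
    ∃ β₀ : ℝ, 0 < β₀ ∧ ∀ β : ℝ, 0 < β → β ≤ β₀ →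
      ¬ (∃ L₀ : ℕ, ∀ L : ℕ, L₀ ≤ L → Odd (L + 1) →
        DiagonalReflectionPositive (d := d) (L := L + 1) (fundamentalRep (Fin N)) β
          ⟨0, by omega⟩ ⟨1, by omega⟩) := by
  obtain ⟨β₀, hβ₀, h⟩ := not_diagonalReflectionPositive_odd_suN_highDim_uniform hd hN
  refine ⟨β₀, hβ₀, fun β hβ hβ1 => ?_⟩
  rintro ⟨L₀, hL₀⟩
  have hodd : Odd (2 * (L₀ + 1) + 1) := ⟨L₀ + 1, rfl⟩
  exact h (2 * (L₀ + 1) + 1) hodd (by omega) β hβ hβ1 (hL₀ (2 * (L₀ + 1)) (by omega) hodd)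

/-- **The Class-B transfer cannot be fed in `d ≥ 4` for `U(N)` (`N ≥ 1`), at any fixed small
coupling** (`not_innerDiagonalRP_even_uN_highDim_uniform`). -/
theorem not_eventually_innerDiagonalRP_highDim_uN {d N : ℕ} (hd : 4 ≤ d) (hN : 1 ≤ N) :
    ∃ β₀ : ℝ, 0 < β₀ ∧ ∀ β : ℝ, 0 < β → β ≤ β₀ →
      ¬ (∀ i j : Fin d, i ≠ j → ∃ L₀ : ℕ, ∀ L : ℕ, L₀ ≤ L →
        InnerDiagonalRP (d := d) (L := L + 1) (unitaryFundamentalRep (Fin N) ℂ) β i j) := by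
  obtain ⟨β₀, hβ₀, h⟩ := not_innerDiagonalRP_even_uN_highDim_uniform hd hN
  refine ⟨β₀, hβ₀, fun β hβ hβ1 H => ?_⟩
  obtain ⟨L₀, hL₀⟩ := H ⟨0, by omega⟩ ⟨1, by omega⟩ (by simp)
  exact h (2 * L₀ + 5 + 1) ⟨L₀ + 3, by ring⟩ (by omega) β hβ hβ1 (hL₀ (2 * L₀ + 5) (by omega))

/-- **Nor along the odd tori with the closed half (`U(N)`, `N ≥ 1`, `d ≥ 4`)**
(`not_diagonalReflectionPositive_odd_uN_highDim_uniform`). -/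
theorem not_eventually_diagonalReflectionPositive_odd_highDim_uN {d N : ℕ} (hd : 4 ≤ d)
    (hN : 1 ≤ N) :
    ∃ β₀ : ℝ, 0 < β₀ ∧ ∀ β : ℝ, 0 < β → β ≤ β₀ →
      ¬ (∃ L₀ : ℕ, ∀ L : ℕ, L₀ ≤ L → Odd (L + 1) →
        DiagonalReflectionPositive (d := d) (L := L + 1) (unitaryFundamentalRep (Fin N) ℂ) β
          ⟨0, by omega⟩ ⟨1, by omega⟩) := by
  obtain ⟨β₀, hβ₀, h⟩ := not_diagonalReflectionPositive_odd_uN_highDim_uniform hd hN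
  refine ⟨β₀, hβ₀, fun β hβ hβ1 => ?_⟩
  rintro ⟨L₀, hL₀⟩
  have hodd : Odd (2 * (L₀ + 1) + 1) := ⟨L₀ + 1, rfl⟩
  exact h (2 * (L₀ + 1) + 1) hodd (by omega) β hβ hβ1 (hL₀ (2 * (L₀ + 1)) (by omega) hodd)

end DiagRPUnif

end

end Summit.QuantumFields.GaugeBoot
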